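import Literature.Analysis.FluidPDE.SobolevVanishingAtInfinity
import Literature.Analysis.FluidPDE.PoincareBall
import Literature.Analysis.FluidPDE.SolenoidalTruncation
import Literature.Analysis.FluidPDE.LipschitzSqIntegrableDecay
import HarnessLib

/-!
# Crux `ExtremiserTransience.NearExtremalTransience` (stmt-NavierStokesRegularity-21883), line `extremiser_liouville`,
# stub K1b — DENSITY LEAF, part 1: THE FAR-FIELD LIMIT OF A HOMOGENEOUS-CLASS FIELD

`--supports stmt-NavierStokesRegularity-21883` (helper).  Author: prover seat `ns-el-k1b` (g2).

The fields of the stub's extended («homogeneous») class are bounded, `C¹` with bounded gradient and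
`Dw ∈ L²(ℝ³)` — but NOT in `L²`.  This file proves the classical far-field structure of such fields
(Galdi 2011, Thm II.6.1 / II.9.1 in the whole space):

* `exists_farFieldLimit` — there is a constant `c`, `‖c‖ ≤ sup ‖w‖`, with `w(x) → c` as `‖x‖ → ∞` and
  `w − c ∈ L⁶(ℝ³)`.

Proof: truncate `w − ⨍_{B(0,2R)} w` with the tree's cut-off `cutoff R`; by the Poincaré inequality on balls
(`PoincareBall.lintegral_ball_sub_average_sq_le`) the truncations have `‖D·‖_{L²} ≲ ‖Dw‖_{L²}` uniformly in
`R`, so Mathlib's Gagliardo–Nirenberg–Sobolev inequality for `C¹_c` maps bounds their `L⁶` norms uniformly; a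
subsequence of the (bounded) ball means converges to some `c`, Fatou gives `w − c ∈ L⁶`, and a Lipschitz map
with `‖·‖³ ∈ L²` tends to zero at infinity (`tendsto_cocompact_of_lipschitzWith_of_integrable_sq`).

This is the input «`w → c` at infinity, `w − c ∈ L⁶`» of the density leaf of K1b
(`ExtremiserLiouville.extendedSharp_of_density`), which is proved in the companion files by the tree's
explicit solenoidal truncation (`Literature.Analysis.FluidPDE.solenoidalTruncation`) applied to `w − c`.

WHAT THIS IS NOT: nothing here is about Navier–Stokes solutions; the crux NET, rung N0 and NS regularity stay
OPEN — nothing here proves NS regularity. [folklore]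
-/

noncomputable section

open Set Filter Topology MeasureTheory Metric Function
open scoped ENNReal NNReal Topology
open Literature.Analysis.FluidPDE

namespace Summit.NavierStokesRegularity.NavierStokesRegularity.Theorems

-- the problem directory repeats the summit name (`NavierStokesRegularity/NavierStokesRegularity`)
set_option linter.dupNamespace false

namespace ExtremiserLiouville

/-! ## Truncations of `w − a` and their uniform `H¹ → L⁶` control -/

/-- The truncation `cutoff R · (w − a)` is `C¹` and compactly supported. [folklore] -/
theorem truncSub_contDiff_hasCompactSupport {w : (EuclideanSpace ℝ (Fin 3)) → (EuclideanSpace ℝ (Fin 3))} (hw : ContDiff ℝ 1 w) (a : (EuclideanSpace ℝ (Fin 3))) {R : ℝ}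
    (hR : 0 < R) :
    ContDiff ℝ 1 (fun x => cutoff R x • (w x - a)) ∧ HasCompactSupport (fun x => cutoff R x • (w x - a)) := by
  refine ⟨(contDiff_cutoff (E := EuclideanSpace ℝ (Fin 3)) (n := 1) R).smul (hw.sub contDiff_const), ?_⟩
  have h := (hasCompactSupport_cutoff (E := EuclideanSpace ℝ (Fin 3)) hR).smul_right (f' := fun x => w x - a)
  exact h

/-- Pointwise gradient bound for the truncation: with `‖D(cutoff R)‖ ≤ C₁/R`,
`‖D(cutoff R · (w − a))(x)‖ₑ ≤ ‖Dw(x)‖ₑ + (C₁/R) ‖w(x) − a‖ₑ 𝟙_{B̄(0,2R)}(x)`. [folklore] -/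
theorem enorm_fderiv_truncSub_le {w : (EuclideanSpace ℝ (Fin 3)) → (EuclideanSpace ℝ (Fin 3))} (hw : ContDiff ℝ 1 w) (a : (EuclideanSpace ℝ (Fin 3))) {R C₁ : ℝ} (hR : 0 < R)
    (hC₁ : 0 ≤ C₁) (hC : ∀ x : (EuclideanSpace ℝ (Fin 3)), ‖fderiv ℝ (cutoff R) x‖ ≤ C₁ / R) (x : (EuclideanSpace ℝ (Fin 3))) :
    ‖fderiv ℝ (fun x => cutoff R x • (w x - a)) x‖ₑ ≤
      ‖fderiv ℝ w x‖ₑ + ENNReal.ofReal (C₁ / R) * (closedBall (0 : (EuclideanSpace ℝ (Fin 3))) (2 * R)).indicator (fun x => ‖w x - a‖ₑ) x := by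
  have hdc : DifferentiableAt ℝ (cutoff (E := (EuclideanSpace ℝ (Fin 3))) R) x := (contDiff_cutoff (n := 1) R).differentiable one_ne_zero x
  have hdw : DifferentiableAt ℝ (fun x => w x - a) x := ((hw.differentiable one_ne_zero) x).sub_const a
  have hfd : fderiv ℝ (fun x => cutoff R x • (w x - a)) x =
      cutoff R x • fderiv ℝ (fun x => w x - a) x + (fderiv ℝ (cutoff R) x).smulRight (w x - a) :=
    fderiv_smul hdc hdw
  have hsub : fderiv ℝ (fun x => w x - a) x = fderiv ℝ w x := fderiv_sub_const a
  rw [hfd, hsub]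
  refine (enorm_add_le (cutoff R x • fderiv ℝ w x) ((fderiv ℝ (cutoff R) x).smulRight (w x - a))).trans
    (add_le_add ?_ ?_)
  · rw [enorm_smul]
    calc ‖cutoff R x‖ₑ * ‖fderiv ℝ w x‖ₑ ≤ 1 * ‖fderiv ℝ w x‖ₑ := by
          gcongr
          rw [← ofReal_norm, ← ENNReal.ofReal_one]
          exact ENNReal.ofReal_le_ofReal (by rw [Real.norm_eq_abs]; exact abs_cutoff_le_one R x)
      _ = ‖fderiv ℝ w x‖ₑ := one_mul _
  · by_cases hx : x ∈ closedBall (0 : (EuclideanSpace ℝ (Fin 3))) (2 * R)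
    · rw [indicator_of_mem hx, ← ofReal_norm, ← ofReal_norm, ← ENNReal.ofReal_mul (by positivity)]
      refine ENNReal.ofReal_le_ofReal ?_
      calc ‖(fderiv ℝ (cutoff R) x).smulRight (w x - a)‖ = ‖fderiv ℝ (cutoff R) x‖ * ‖w x - a‖ :=
            ContinuousLinearMap.norm_smulRight_apply _ _
        _ ≤ C₁ / R * ‖w x - a‖ := by gcongr; exact hC x
    · have hx' : ¬ (R ≤ ‖x‖ ∧ ‖x‖ ≤ 2 * R) := by
        intro h
        exact hx (mem_closedBall_zero_iff.2 h.2)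
      rw [(fderiv_cutoff_eq_zero_of_not_mem hR hx').1, ContinuousLinearMap.zero_smulRight, ← ofReal_norm, norm_zero,
        ENNReal.ofReal_zero]
      exact bot_le

/-- `L²` gradient bound for the truncation: `∫ ‖D(cutoff R (w − a))‖² ≤ 2∫‖Dw‖² + 2(C₁/R)² ∫_{B̄(0,2R)} ‖w − a‖²`.
[folklore] -/
theorem lintegral_fderiv_truncSub_sq_le {w : (EuclideanSpace ℝ (Fin 3)) → (EuclideanSpace ℝ (Fin 3))} (hw : ContDiff ℝ 1 w) (a : (EuclideanSpace ℝ (Fin 3))) {R C₁ : ℝ} (hR : 0 < R)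
    (hC₁ : 0 ≤ C₁) (hC : ∀ x : (EuclideanSpace ℝ (Fin 3)), ‖fderiv ℝ (cutoff R) x‖ ≤ C₁ / R) :
    ∫⁻ x, ‖fderiv ℝ (fun x => cutoff R x • (w x - a)) x‖ₑ ^ 2 ≤
      2 * (∫⁻ x, ‖fderiv ℝ w x‖ₑ ^ 2) +
        2 * ENNReal.ofReal ((C₁ / R) ^ 2) * ∫⁻ x in closedBall (0 : (EuclideanSpace ℝ (Fin 3))) (2 * R), ‖w x - a‖ₑ ^ 2 := by
  have hmeas : Measurable fun x => ‖fderiv ℝ w x‖ₑ ^ 2 :=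
    (hw.continuous_fderiv one_ne_zero).measurable.enorm.pow_const _
  calc ∫⁻ x, ‖fderiv ℝ (fun x => cutoff R x • (w x - a)) x‖ₑ ^ 2
      ≤ ∫⁻ x, (‖fderiv ℝ w x‖ₑ +
          ENNReal.ofReal (C₁ / R) * (closedBall (0 : (EuclideanSpace ℝ (Fin 3))) (2 * R)).indicator (fun x => ‖w x - a‖ₑ) x) ^ 2 :=
        lintegral_mono fun x => pow_le_pow_left' (enorm_fderiv_truncSub_le hw a hR hC₁ hC x) 2
    _ ≤ ∫⁻ x, (2 * ‖fderiv ℝ w x‖ₑ ^ 2 +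
          2 * (ENNReal.ofReal (C₁ / R) * (closedBall (0 : (EuclideanSpace ℝ (Fin 3))) (2 * R)).indicator (fun x => ‖w x - a‖ₑ) x) ^ 2) :=
        lintegral_mono fun x => PoincareBall.add_sq_le_two_mul_sq_add _ _
    _ = 2 * (∫⁻ x, ‖fderiv ℝ w x‖ₑ ^ 2) +
          2 * ∫⁻ x, (ENNReal.ofReal (C₁ / R) * (closedBall (0 : (EuclideanSpace ℝ (Fin 3))) (2 * R)).indicator (fun x => ‖w x - a‖ₑ) x) ^ 2 := by
        rw [lintegral_add_left (hmeas.const_mul 2), lintegral_const_mul' _ _ (by norm_num),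
          lintegral_const_mul' _ _ (by norm_num)]
    _ = 2 * (∫⁻ x, ‖fderiv ℝ w x‖ₑ ^ 2) +
          2 * ENNReal.ofReal ((C₁ / R) ^ 2) * ∫⁻ x in closedBall (0 : (EuclideanSpace ℝ (Fin 3))) (2 * R), ‖w x - a‖ₑ ^ 2 := by
        congr 1
        rw [mul_assoc, ← lintegral_indicator measurableSet_closedBall,
          ← lintegral_const_mul' _ _ ENNReal.ofReal_ne_top]
        congr 1
        refine lintegral_congr fun x => ?_
        by_cases hx : x ∈ closedBall (0 : (EuclideanSpace ℝ (Fin 3))) (2 * R)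
        · rw [indicator_of_mem hx, indicator_of_mem hx, mul_pow, ← ENNReal.ofReal_pow (by positivity)]
        · rw [indicator_of_notMem hx, indicator_of_notMem hx]; simp

/-- Poincaré on `B(0,3R)` for the mean `a_R = ⨍_{B(0,3R)} w`, restricted to the closed ball `B̄(0,2R)`:
`∫_{B̄(0,2R)} ‖w − a_R‖² ≤ 8·(36 R²)·∫ ‖Dw‖²`. [cite: Evans2010, §5.8.1 Thm. 2] -/
theorem lintegral_closedBall_sub_average_sq_le {w : (EuclideanSpace ℝ (Fin 3)) → (EuclideanSpace ℝ (Fin 3))} (hw : ContDiff ℝ 1 w) {R : ℝ} (hR : 0 < R) :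
    ∫⁻ x in closedBall (0 : (EuclideanSpace ℝ (Fin 3))) (2 * R), ‖w x - ⨍ y in ball (0 : (EuclideanSpace ℝ (Fin 3))) (3 * R), w y‖ₑ ^ 2 ≤
      8 * ENNReal.ofReal (36 * R ^ 2) * ∫⁻ x, ‖fderiv ℝ w x‖ₑ ^ 2 := by
  have hsub : closedBall (0 : (EuclideanSpace ℝ (Fin 3))) (2 * R) ⊆ ball (0 : (EuclideanSpace ℝ (Fin 3))) (3 * R) :=
    closedBall_subset_ball (by linarith)
  refine (lintegral_mono_set hsub).trans ?_
  have h := PoincareBall.lintegral_ball_sub_average_sq_le (F := (EuclideanSpace ℝ (Fin 3))) hw (0 : (EuclideanSpace ℝ (Fin 3))) (r := 3 * R) (by positivity)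
  rw [finrank_euclideanSpace_fin] at h
  refine h.trans ?_
  have h4 : ENNReal.ofReal (4 * (3 * R) ^ 2) = ENNReal.ofReal (36 * R ^ 2) := by ring_nf
  rw [h4]
  have h8 : (2 : ℝ≥0∞) ^ 3 = 8 := by norm_num
  rw [h8]
  exact mul_le_mul' le_rfl (setLIntegral_le_lintegral _ _)

/-- **Uniform `L⁶` bound for the truncations** `cutoff R · (w − ⨍_{B(0,2R)} w)`: there is `K < ∞` (depending
on `w` only through `∫‖Dw‖²`) bounding their `L⁶` norms for all `R > 0` (Poincaré + Gagliardo–Nirenberg–Sobolev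
for `C¹_c` maps). [cite: Evans2010, §5.6.1] -/
theorem exists_eLpNorm_truncSub_le {w : (EuclideanSpace ℝ (Fin 3)) → (EuclideanSpace ℝ (Fin 3))} (hw : ContDiff ℝ 1 w) (hD : ∫⁻ x, ‖fderiv ℝ w x‖ₑ ^ 2 < ⊤) :
    ∃ K : ℝ≥0∞, K < ⊤ ∧ ∀ R : ℝ, 0 < R →
      eLpNorm (fun x => cutoff R x • (w x - ⨍ y in ball (0 : (EuclideanSpace ℝ (Fin 3))) (3 * R), w y)) 6 volume ≤ K := by
  obtain ⟨C₁, hC₁, hC⟩ := exists_norm_fderiv_cutoff_le (E := (EuclideanSpace ℝ (Fin 3)))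
  set D : ℝ≥0∞ := ∫⁻ x, ‖fderiv ℝ w x‖ₑ ^ 2 with hDdef
  -- the uniform `L²` gradient bound
  set G : ℝ≥0∞ := 2 * D + 2 * ENNReal.ofReal (C₁ ^ 2) * (8 * 36 * D) with hGdef
  have hGtop : G < ⊤ := by
    have h1 : 2 * D < ⊤ := ENNReal.mul_lt_top (by norm_num) hD
    have h2 : 2 * ENNReal.ofReal (C₁ ^ 2) * (8 * 36 * D) < ⊤ :=
      ENNReal.mul_lt_top (ENNReal.mul_lt_top (by norm_num) ENNReal.ofReal_lt_top)
        (ENNReal.mul_lt_top (by norm_num) hD)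
    exact ENNReal.add_lt_top.2 ⟨h1, h2⟩
  have hgrad : ∀ R : ℝ, 0 < R →
      ∫⁻ x, ‖fderiv ℝ (fun x => cutoff R x • (w x - ⨍ y in ball (0 : (EuclideanSpace ℝ (Fin 3))) (3 * R), w y)) x‖ₑ ^ 2 ≤ G := by
    intro R hR
    set a : (EuclideanSpace ℝ (Fin 3)) := ⨍ y in ball (0 : (EuclideanSpace ℝ (Fin 3))) (3 * R), w y with hadef
    refine (lintegral_fderiv_truncSub_sq_le hw a hR hC₁ (hC R hR)).trans ?_
    have hP := lintegral_closedBall_sub_average_sq_le hw hR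
    rw [← hadef] at hP
    calc 2 * D + 2 * ENNReal.ofReal ((C₁ / R) ^ 2) * ∫⁻ x in closedBall (0 : (EuclideanSpace ℝ (Fin 3))) (2 * R), ‖w x - a‖ₑ ^ 2
        ≤ 2 * D + 2 * ENNReal.ofReal ((C₁ / R) ^ 2) * (8 * ENNReal.ofReal (36 * R ^ 2) * D) := by gcongr
      _ = G := by
          rw [hGdef]
          congr 1
          have hc : ENNReal.ofReal ((C₁ / R) ^ 2) * ENNReal.ofReal (36 * R ^ 2) = ENNReal.ofReal (C₁ ^ 2) * 36 := by
            rw [← ENNReal.ofReal_mul (by positivity)]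
            have : (C₁ / R) ^ 2 * (36 * R ^ 2) = C₁ ^ 2 * 36 := by field_simp
            rw [this, ENNReal.ofReal_mul (by positivity)]
            norm_num
          calc 2 * ENNReal.ofReal ((C₁ / R) ^ 2) * (8 * ENNReal.ofReal (36 * R ^ 2) * D)
              = 2 * 8 * (ENNReal.ofReal ((C₁ / R) ^ 2) * ENNReal.ofReal (36 * R ^ 2)) * D := by ring
            _ = 2 * 8 * (ENNReal.ofReal (C₁ ^ 2) * 36) * D := by rw [hc]
            _ = 2 * ENNReal.ofReal (C₁ ^ 2) * (8 * 36 * D) := by ring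
  -- Gagliardo–Nirenberg–Sobolev for the compactly supported `C¹` truncations
  have hn : 0 < Module.finrank ℝ (EuclideanSpace ℝ (Fin 3)) := by rw [finrank_euclideanSpace_fin]; norm_num
  have hp' : (((6 : ℝ≥0) : ℝ))⁻¹ = ((2 : ℝ≥0) : ℝ)⁻¹ - (Module.finrank ℝ (EuclideanSpace ℝ (Fin 3)) : ℝ)⁻¹ := by
    rw [finrank_euclideanSpace_fin]; push_cast; norm_num
  refine ⟨(SNormLESNormFDerivOfEqConst (EuclideanSpace ℝ (Fin 3)) (volume : Measure (EuclideanSpace ℝ (Fin 3))) 2 : ℝ≥0∞) * G ^ (1 / 2 : ℝ),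
    ENNReal.mul_lt_top ENNReal.coe_lt_top (ENNReal.rpow_lt_top_of_nonneg (by norm_num) hGtop.ne), fun R hR => ?_⟩
  obtain ⟨h1, h2⟩ := truncSub_contDiff_hasCompactSupport hw (⨍ y in ball (0 : (EuclideanSpace ℝ (Fin 3))) (3 * R), w y) hR
  have hGNS := eLpNorm_le_eLpNorm_fderiv_of_eq (volume : Measure (EuclideanSpace ℝ (Fin 3))) h1 h2 (p := 2) (p' := 6) (by norm_num) hn hp'
  refine hGNS.trans ?_
  push_cast
  gcongr
  -- `eLpNorm (D·) 2 = (∫⁻ ‖D·‖ₑ²)^{1/2} ≤ G^{1/2}`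
  rw [eLpNorm_eq_lintegral_rpow_enorm_toReal (by norm_num) (by norm_num)]
  simp only [ENNReal.toReal_ofNat, one_div]
  refine ENNReal.rpow_le_rpow ?_ (by norm_num)
  have := hgrad R hR
  refine le_trans (le_of_eq ?_) this
  congr 1; funext x
  rw [← ENNReal.rpow_natCast]; norm_num

/-! ## The far-field limit -/

/-- The mean of a field bounded by `M` over a ball lies in the closed `M`-ball. [folklore] -/
theorem norm_average_ball_le {w : (EuclideanSpace ℝ (Fin 3)) → (EuclideanSpace ℝ (Fin 3))} {M : ℝ} (hM : ∀ x, ‖w x‖ ≤ M) {r : ℝ}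
    (hr : 0 < r) : ‖⨍ y in ball (0 : (EuclideanSpace ℝ (Fin 3))) r, w y‖ ≤ M := by
  rw [setAverage_eq]
  have hvol : volume (ball (0 : (EuclideanSpace ℝ (Fin 3))) r) < ⊤ := measure_ball_lt_top
  have hpos : 0 < (volume : Measure (EuclideanSpace ℝ (Fin 3))).real (ball (0 : (EuclideanSpace ℝ (Fin 3))) r) :=
    ENNReal.toReal_pos (measure_ball_pos volume (0 : (EuclideanSpace ℝ (Fin 3))) hr).ne' hvol.ne
  have hint : ‖∫ y in ball (0 : (EuclideanSpace ℝ (Fin 3))) r, w y‖ ≤ M * (volume : Measure (EuclideanSpace ℝ (Fin 3))).real (ball (0 : (EuclideanSpace ℝ (Fin 3))) r) :=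
    norm_setIntegral_le_of_norm_le_const hvol fun y _ => hM y
  rw [norm_smul, norm_inv, Real.norm_of_nonneg hpos.le]
  calc ((volume : Measure (EuclideanSpace ℝ (Fin 3))).real (ball (0 : (EuclideanSpace ℝ (Fin 3))) r))⁻¹ * ‖∫ y in ball (0 : (EuclideanSpace ℝ (Fin 3))) r, w y‖
      ≤ ((volume : Measure (EuclideanSpace ℝ (Fin 3))).real (ball (0 : (EuclideanSpace ℝ (Fin 3))) r))⁻¹ * (M * (volume : Measure (EuclideanSpace ℝ (Fin 3))).real (ball (0 : (EuclideanSpace ℝ (Fin 3))) r)) := by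
        gcongr
    _ = M := by field_simp

/-- A bounded Lipschitz map with `‖v‖⁶` integrable tends to `0` at infinity (apply the tree's
`tendsto_cocompact_of_lipschitzWith_of_integrable_sq` to the Lipschitz function `‖v‖³`). [folklore] -/
theorem tendsto_cocompact_of_lipschitz_of_integrable_pow_six {v : (EuclideanSpace ℝ (Fin 3)) → (EuclideanSpace ℝ (Fin 3))} {L : ℝ≥0} (hL : LipschitzWith L v)
    {A : ℝ} (hA : ∀ x, ‖v x‖ ≤ A) (hint : Integrable (fun x => ‖v x‖ ^ (6 : ℕ))) :
    Tendsto v (cocompact (EuclideanSpace ℝ (Fin 3))) (𝓝 0) := by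
  have hA0 : 0 ≤ A := (norm_nonneg _).trans (hA 0)
  set g : (EuclideanSpace ℝ (Fin 3)) → ℝ := fun x => ‖v x‖ ^ 3 with hgdef
  -- `g` is Lipschitz with constant `3 A² L`
  have hcube : ∀ s t : ℝ, 0 ≤ s → s ≤ A → 0 ≤ t → t ≤ A → |s ^ 3 - t ^ 3| ≤ 3 * A ^ 2 * |s - t| := by
    intro s t hs hsA ht htA
    have hfac : s ^ 3 - t ^ 3 = (s - t) * (s ^ 2 + s * t + t ^ 2) := by ring
    rw [hfac, abs_mul, mul_comm]
    gcongr
    rw [abs_of_nonneg (by positivity)]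
    nlinarith [mul_nonneg hs ht, mul_le_mul hsA htA ht hA0, pow_le_pow_left₀ hs hsA 2, pow_le_pow_left₀ ht htA 2]
  have hg : LipschitzWith (⟨3 * A ^ 2, by positivity⟩ * L) g := by
    refine LipschitzWith.of_dist_le_mul fun x y => ?_
    rw [Real.dist_eq, hgdef]
    push_cast
    calc |‖v x‖ ^ 3 - ‖v y‖ ^ 3| ≤ 3 * A ^ 2 * |‖v x‖ - ‖v y‖| :=
          hcube _ _ (norm_nonneg _) (hA x) (norm_nonneg _) (hA y)
      _ ≤ 3 * A ^ 2 * (L * dist x y) := by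
          gcongr
          calc |‖v x‖ - ‖v y‖| ≤ ‖v x - v y‖ := abs_norm_sub_norm_le _ _
            _ = dist (v x) (v y) := (dist_eq_norm _ _).symm
            _ ≤ L * dist x y := hL.dist_le_mul x y
      _ = 3 * A ^ 2 * L * dist x y := by ring
  have hint2 : Integrable fun x => ‖g x‖ ^ 2 := by
    refine hint.congr (ae_of_all _ fun x => ?_)
    simp only [hgdef, Real.norm_eq_abs, abs_pow, abs_norm]
    ring
  have hg0 := tendsto_cocompact_of_lipschitzWith_of_integrable_sq hg hint2
  -- `‖v‖³ → 0` forces `v → 0`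
  rw [tendsto_zero_iff_norm_tendsto_zero]
  rw [Metric.tendsto_nhds] at hg0 ⊢
  intro ε hε
  filter_upwards [hg0 (ε ^ 3) (by positivity)] with x hx
  rw [Real.dist_eq, sub_zero] at hx ⊢
  rw [abs_of_nonneg (norm_nonneg _)]
  rw [hgdef] at hx
  simp only [abs_pow, abs_norm] at hx
  by_contra h
  rw [not_lt] at h
  exact (lt_irrefl _) ((pow_le_pow_left₀ hε.le h 3).trans_lt hx)

/-- **The far-field limit of a homogeneous-class field** (Galdi 2011, Thm II.6.1/II.9.1, whole space): a `C¹`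
field `w : ℝ³ → ℝ³` with `‖w‖ ≤ M`, `‖Dw‖ ≤ B` and `Dw ∈ L²(ℝ³)` has a constant far-field limit `c`,
`‖c‖ ≤ M`, `w(x) → c` as `‖x‖ → ∞`, and `w − c ∈ L⁶(ℝ³)`. [cite: Galdi2011, Thm II.6.1] -/
theorem exists_farFieldLimit {w : (EuclideanSpace ℝ (Fin 3)) → (EuclideanSpace ℝ (Fin 3))} (hw : ContDiff ℝ 1 w) {M B : ℝ} (hM : ∀ x, ‖w x‖ ≤ M)
    (hB : ∀ x, ‖fderiv ℝ w x‖ ≤ B) (hD : ∫⁻ x, ‖fderiv ℝ w x‖ₑ ^ 2 < ⊤) :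
    ∃ c : (EuclideanSpace ℝ (Fin 3)), ‖c‖ ≤ M ∧ Tendsto (fun x => w x - c) (cocompact (EuclideanSpace ℝ (Fin 3))) (𝓝 0) ∧ MemLp (fun x => w x - c) 6 volume := by
  have hwc : Continuous w := hw.continuous
  have hM0 : 0 ≤ M := (norm_nonneg _).trans (hM 0)
  obtain ⟨K, hK, hKb⟩ := exists_eLpNorm_truncSub_le hw hD
  -- ball means along `R = n + 1` and a convergent subsequence
  set a : ℕ → (EuclideanSpace ℝ (Fin 3)) := fun n => ⨍ y in ball (0 : (EuclideanSpace ℝ (Fin 3))) (3 * ((n : ℝ) + 1)), w y with hadef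
  have ha : ∀ n, a n ∈ closedBall (0 : (EuclideanSpace ℝ (Fin 3))) M := fun n =>
    mem_closedBall_zero_iff.2 (norm_average_ball_le hM (by positivity))
  obtain ⟨c, -, ψ, hψ, hconv⟩ := tendsto_subseq_of_bounded isBounded_closedBall ha
  -- the truncations along the subsequence converge pointwise to `w − c`
  set φ : ℕ → (EuclideanSpace ℝ (Fin 3)) → (EuclideanSpace ℝ (Fin 3)) := fun k x => cutoff ((ψ k : ℝ) + 1) x • (w x - a (ψ k)) with hφdef
  have hψtop : Tendsto (fun k => (ψ k : ℝ) + 1) atTop atTop :=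
    (tendsto_natCast_atTop_atTop.comp hψ.tendsto_atTop).atTop_add tendsto_const_nhds
  have hpt : ∀ x, Tendsto (fun k => φ k x) atTop (𝓝 (w x - c)) := by
    intro x
    have h1 : ∀ᶠ k in atTop, cutoff ((ψ k : ℝ) + 1) x = 1 := (eventually_cutoff_eq_one x).filter_mono hψtop
    have h2 : Tendsto (fun k => w x - a (ψ k)) atTop (𝓝 (w x - c)) := tendsto_const_nhds.sub hconv
    refine h2.congr' ?_
    filter_upwards [h1] with k hk
    simp [hφdef, hk]
  -- Fatou in `L⁶`
  have hmeas : ∀ k, AEStronglyMeasurable (φ k) volume := fun k =>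
    (truncSub_contDiff_hasCompactSupport hw (a (ψ k)) (by positivity)).1.continuous.aestronglyMeasurable
  have hF := MeasureTheory.Lp.eLpNorm_lim_le_liminf_eLpNorm hmeas (fun x => w x - c) (Eventually.of_forall hpt)
    (p := (6 : ℝ≥0∞))
  have hbound : eLpNorm (fun x => w x - c) 6 volume ≤ K := by
    refine hF.trans ?_
    calc liminf (fun k => eLpNorm (φ k) 6 volume) atTop ≤ liminf (fun _ : ℕ => K) atTop :=
          liminf_le_liminf (Eventually.of_forall fun k => hKb _ (by positivity))
      _ = K := liminf_const _
  have hmem : MemLp (fun x => w x - c) 6 volume :=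
    ⟨(hwc.sub continuous_const).aestronglyMeasurable, hbound.trans_lt hK⟩
  -- decay at infinity: `w − c` is Lipschitz, bounded, with `‖·‖⁶` integrable
  have hB0 : 0 ≤ B := (norm_nonneg _).trans (hB 0)
  have hLip : LipschitzWith ⟨B, hB0⟩ (fun x => w x - c) := by
    refine lipschitzWith_of_nnnorm_fderiv_le (((hw.differentiable one_ne_zero)).sub_const c) fun x => ?_
    rw [fderiv_sub_const, ← NNReal.coe_le_coe, coe_nnnorm]
    exact hB x
  have hint : Integrable (fun x => ‖w x - c‖ ^ (6 : ℕ)) := by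
    have := hmem.integrable_norm_rpow (by norm_num) (by norm_num)
    simpa [ENNReal.toReal_ofNat] using this
  have hdec : Tendsto (fun x => w x - c) (cocompact (EuclideanSpace ℝ (Fin 3))) (𝓝 0) :=
    tendsto_cocompact_of_lipschitz_of_integrable_pow_six hLip (A := M + ‖c‖)
      (fun x => (norm_sub_le _ _).trans (by linarith [hM x])) hint
  -- `‖c‖ ≤ M`: `c` is the limit of values of `w` along the (non-trivial) cocompact filter
  have hcM : ‖c‖ ≤ M := by
    have hv : Tendsto w (cocompact (EuclideanSpace ℝ (Fin 3))) (𝓝 c) := by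
      have h := hdec.add_const c
      simpa using h
    exact le_of_tendsto' hv.norm fun x => hM x
  exact ⟨c, hcM, hdec, hmem⟩

end ExtremiserLiouville

end Summit.NavierStokesRegularity.NavierStokesRegularity.Theorems

end
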